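import Literature.MathematicalPhysics.QuantumLattice.XXZAntiferromagnetThermalOrder
import Literature.MathematicalPhysics.QuantumLattice.KomaTasakiGriffithsTheoremSubsequence
import Literature.MathematicalPhysics.QuantumLattice.XYOrderDischarges
import Literature.MathematicalPhysics.QuantumLattice.HeisenbergModelGlobalRotationProofs
import Literature.MathematicalPhysics.QuantumLattice.HardCoreBosonHalfFillingOptimal
import Literature.MathematicalPhysics.QuantumLattice.TorusTestPotential
import Literature.MathematicalPhysics.QuantumLattice.SpinSystemProofs
import Literature.MathematicalPhysics.QuantumLattice.LatticeToriLROProofs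
import HarnessLib

/-!
# The XXZ model IS a Koma–Tasaki `ℤ₂` system with a `U(1)` generator, and the positive-temperature
# off-diagonal long-range order of hard-core lattice bosons (`d ≥ 3`) forces a spontaneous `U(1)`-breaking
# order parameter `≥ √2 σ` under every infinitesimal symmetry-breaking field (KT93 Thm 2.1 / Cor 2.2 BY NAME)

T. Koma, H. Tasaki, *Symmetry breaking in Heisenberg antiferromagnets*, Commun. Math. Phys. **158** (1993)
191–214 [KomaTasaki1993]: §2 (2.1)–(2.12), Theorem 2.1 (`m_s ≥ σ`), Corollary 2.2 and the Remark after
Theorem 6.1 ("the models with an `SO(2) = U(1)` invariance, where we get a factor `√2` … quantum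
antiferromagnets with an XY-like anisotropy").  The abstract theorems are PROVED in the tree
(`KomaTasaki.kt93_theorem_2_1_holds`, `Z2System.kt93_corollary_2_2_u1`) and freed of hypothesis i) (the
thermodynamic limit of the free energy) in `KomaTasakiGriffithsTheoremSubsequence.lean`.  The long-range
order input is the tree's `hardCoreBoson_thermal_planar` (`XXZAntiferromagnetThermalOrder.lean`): for `d ≥ 3`,
`S = n/2 ≥ ½`, `-1 ≤ Δ ≤ 0` and `β ≥ β₀` the Gibbs states of `xxzHamiltonian n (torusGraph d L) (-1) Δ`
(`= -Σ_{⟨x,y⟩}(SˣSˣ + SʸSʸ + ΔSᶻSᶻ)`, planar ferromagnet = hard-core lattice bosons with nearest-neighbour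
repulsion for `S = ½`, [Tasaki2019Tower] §3.2) have plain long-range order of `Sʸ`:
`liminf_k (2k)^{-2d} Σ_{x,y}⟨Sʸ_xSʸ_y⟩_β > 0` (Björnberg–Ueltschi 2022 / DLS 1978 / KLS 1988).

* §1 (generic graph, PROVED): the symmetrised local XXZ terms `h_x = (J/2)Σ_{y∼x}(Bˣ_{xy}+Bʸ_{xy}+ΔBᶻ_{xy})`
  (`XXZKT.localHam`, `Σ_x h_x = xxzHamiltonian`, Hermitian, `‖h_x‖ ≤ (|J|/2)·deg·(2+|Δ|)s²`, commuting with
  spins off the closed neighbourhood); the `ℤ₂` unitary = the HALF TURN about the `3`-axis (square of the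
  tree's quarter turn `⨂_x diag((-i)^k)`: `Sˣ ↦ -Sˣ`, `Sʸ ↦ -Sʸ`, `Sᶻ ↦ Sᶻ`, fixes `H_XXZ`); the `U(1)`
  data `C = Sᶻ_tot`: `[Sᶻ_tot, Sˣ_tot] = iSʸ_tot`, `[Sᶻ_tot, Sʸ_tot] = -iSˣ_tot`, `[Sˣ_tot, Sʸ_tot] = iSᶻ_tot`.
* §2 (torus): **`XXZKT.z2System d L n J Δ : KomaTasaki.Z2System |Λ| h̄ s (2d+2) (TorusSite d L → Fin (n+1))`**
  with `O_Λ = Sʸ_tot` (the component carrying the long-range order of `hardCoreBoson_thermal_planar`);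
  dictionary (`fieldHamiltonian B = H_XXZ - B·Sʸ_tot`, `moment β 1 = |Λ|⁻²Σ_{x,y}Re⟨Sʸ_xSʸ_y⟩_β`),
  `log dim = |Λ| log(n+1)`.
* §3 **`hardCoreBoson_thermal_spontaneousOrder`**: `d ≥ 3`, `1 ≤ n`, `-1 ≤ Δ ≤ 0`: there is `β₀ > 0` such
  that for every `β ≥ β₀` there is `σ > 0` (the long-range order of the symmetric Gibbs states at `β`) with:
  for every field `B > 0` and `ε > 0`, eventually on the even tori `(ℤ/2kℤ)^d`,
  **`√2 σ - ε ≤ |Λ|⁻¹ Re⟨Sʸ_tot⟩_{β, H_XXZ(-1,Δ) - B·Sʸ_tot}`** — off-diagonal long-range order at `T > 0`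
  (`d ≥ 3`) forces a spontaneous `U(1)`-breaking order parameter (for `S = ½`: the Bose-condensate order
  parameter `|Λ|⁻¹Σ_x⟨(a_x - a†_x)/2i⟩` under an infinitesimal field), volume limit first, WITHOUT the
  free-energy hypothesis i); the plain KT93 Thm 2.1 form (`σ - ε`) as well.

Everything is PROVED; one definition with body (the instance) plus the local data; no named fact.  NOT a
statement about the Hubbard model (hard-core bosons / XXZ spins).

## References

* [KomaTasaki1993] T. Koma, H. Tasaki, Commun. Math. Phys. 158 (1993) 191–214, §2, Theorem 2.1, Corollary 2.2,
  Remark after Theorem 6.1.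
* [Tasaki2019Tower] H. Tasaki, J. Stat. Phys. 174 (2019) 735–761, §3.2 (XXZ / hard-core bosons, (3.7)).
* [BjornbergUeltschi2022] J. E. Björnberg, D. Ueltschi, J. Math. Phys. 63 (2022), Theorem 3.2.
* [KLS1988PRL] T. Kennedy, E. H. Lieb, B. S. Shastry, Phys. Rev. Lett. 61 (1988) 2582, eq. (1).
* [Tasaki2020] H. Tasaki, *Physics and Mathematics of Quantum Many-Body Systems*, Springer 2020, §2.1–2.4.
-/

noncomputable section

open Matrix Finset Filter Topology
open scoped ComplexOrder Matrix.Norms.L2Operator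
open Literature.MathematicalPhysics.QuantumLattice Literature.MathematicalPhysics.QuantumLattice.SpinOperators
  Literature.Probability.LatticeModels

namespace Literature.MathematicalPhysics.QuantumLattice

namespace XXZKT

/-! ### §1. Generic graph: local terms, the half turn, the `U(1)` commutators -/

section Graph

variable {Λ : Type*} [Fintype Λ] [DecidableEq Λ] (n : ℕ) (G : SimpleGraph Λ) [DecidableRel G.Adj]

/-- Ordered adjacent pairs versus edges: `Σ_x Σ_y [x ∼ y] g x y = Σ_{e = {a,b}} (g a b + g b a)`
(any additive commutative monoid). [folklore] -/
private theorem sum_sum_adj_eq_sum_edgeFinset {M : Type*} [AddCommMonoid M] (g : Λ → Λ → M) :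
    ∑ x, ∑ y, (if G.Adj x y then g x y else 0) =
      ∑ e ∈ G.edgeFinset, Sym2.lift ⟨fun a b => g a b + g b a, fun _ _ => add_comm _ _⟩ e := by
  set A := ((Finset.univ : Finset Λ) ×ˢ (Finset.univ : Finset Λ)).filter (fun p => G.Adj p.1 p.2) with hA
  have hL : ∑ p ∈ A, g p.1 p.2 = ∑ x, ∑ y, (if G.Adj x y then g x y else 0) := by
    rw [hA, Finset.sum_filter, Finset.sum_product]
  have hmaps : ∀ p ∈ A, s(p.1, p.2) ∈ G.edgeFinset := fun p hp => by
    rw [SimpleGraph.mem_edgeFinset]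
    exact (Finset.mem_filter.1 hp).2
  rw [← hL, ← Finset.sum_fiberwise_of_maps_to hmaps]
  refine Finset.sum_congr rfl fun e he => ?_
  induction e with
  | h a b =>
    have hab : G.Adj a b := by simpa using he
    have hfib : A.filter (fun p => s(p.1, p.2) = s(a, b)) = {(a, b), (b, a)} := by
      ext ⟨p, q⟩
      simp only [hA, Finset.mem_filter, Finset.mem_product, Finset.mem_univ, true_and, Finset.mem_insert,
        Finset.mem_singleton, Prod.mk.injEq]
      constructor
      · rintro ⟨-, h⟩
        exact Sym2.eq_iff.1 h
      · rintro (⟨rfl, rfl⟩ | ⟨rfl, rfl⟩)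
        · exact ⟨hab, rfl⟩
        · exact ⟨hab.symm, Sym2.eq_swap⟩
    have hne : (a, b) ≠ (b, a) := fun h => hab.ne (Prod.mk.inj h).1
    rw [hfib, Finset.sum_pair hne, Sym2.lift_mk]

/-- The XXZ bond `Bˣ_{xy} + Bʸ_{xy} + Δ Bᶻ_{xy}` (symmetrised bond operators `spinBond`).
[cite: Tasaki2020, §2.4 eq. (2.4.1)] -/
def bond (Δ : ℝ) (x y : Λ) : Op Λ (n + 1) :=
  spinBond n 0 x y + spinBond n 1 x y + (Δ : ℂ) • spinBond n 2 x y

/-- The bond is symmetric in its sites. [cite: Tasaki2020, §2.4] -/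
theorem bond_comm (Δ : ℝ) (x y : Λ) : bond n Δ y x = bond n Δ x y := by
  simp only [bond, spinBond_comm]

/-- The bond is Hermitian. [cite: Tasaki2020, §2.4] -/
theorem bond_isHermitian (Δ : ℝ) (x y : Λ) : (bond n Δ x y).IsHermitian := by
  unfold bond
  refine ((spinBond_isHermitian n 0 x y).add (spinBond_isHermitian n 1 x y)).add ?_
  exact IsHermitian.smul (spinBond_isHermitian n 2 x y) (by rw [isSelfAdjoint_iff, Complex.star_def, Complex.conj_ofReal])

/-- `xxzHamiltonian n G J Δ = J Σ_{e} bond(e)`. [cite: Tasaki2020, §2.4 eq. (2.4.1)] -/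
theorem xxzHamiltonian_eq_sum_bond (J Δ : ℝ) :
    xxzHamiltonian n G J Δ =
      (J : ℂ) • ∑ e ∈ G.edgeFinset, Sym2.lift ⟨fun x y => bond n Δ x y, fun x y => (bond_comm n Δ y x)⟩ e :=
  rfl

open scoped MatrixOrder in
/-- `‖S^α_x‖ ≤ S = n/2`: `0 ≤ (S^α_x)² ≤ S²·1` in the Loewner order (`posSemidef_sq_smul_one_sub_siteSpin_sq`),
monotonicity of the C⋆-norm on the positive cone and `‖TᴴT‖ = ‖T‖²` (the spectrum of `S^α` is `{-S,…,S}`).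
[cite: Tasaki2020, §2.1 eq. (2.1.3)] -/
theorem norm_siteSpin_le_half (x : Λ) (γ : Fin 3) : ‖(siteSpin n x γ : Op Λ (n + 1))‖ ≤ (n : ℝ) / 2 := by
  letI : CStarAlgebra (Op Λ (n + 1)) := {}
  set T : Op Λ (n + 1) := siteSpin n x γ
  have hH : Tᴴ = T := (siteSpin_isHermitian n x γ).eq
  have h0 : (0 : Op Λ (n + 1)) ≤ T * T := by
    rw [Matrix.nonneg_iff_posSemidef]
    nth_rewrite 1 [← hH]
    exact posSemidef_conjTranspose_mul_self T
  have h1 : T * T ≤ (((n : ℂ) / 2) ^ 2) • (1 : Op Λ (n + 1)) := by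
    rw [Matrix.le_iff]
    exact posSemidef_sq_smul_one_sub_siteSpin_sq n x γ
  have h2 : ‖T * T‖ ≤ ‖(((n : ℂ) / 2) ^ 2) • (1 : Op Λ (n + 1))‖ :=
    CStarAlgebra.norm_le_norm_of_nonneg_of_le h0 h1
  have h3 : ‖T * T‖ = ‖T‖ * ‖T‖ := by
    nth_rewrite 1 [← hH]
    exact Matrix.l2_opNorm_conjTranspose_mul_self T
  have h4 : ‖(((n : ℂ) / 2) ^ 2) • (1 : Op Λ (n + 1))‖ = ((n : ℝ) / 2) ^ 2 := by
    rw [norm_smul, CStarRing.norm_one, mul_one,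
      show ((n : ℂ) / 2) ^ 2 = ((((n : ℝ) / 2) ^ 2 : ℝ) : ℂ) by push_cast; ring, Complex.norm_real,
      Real.norm_of_nonneg (by positivity)]
  rw [h3, h4] at h2
  have hS : (0 : ℝ) ≤ (n : ℝ) / 2 := by positivity
  nlinarith [norm_nonneg T, h2, hS]

/-- A uniform single-site constant `s = S + 1 = n/2 + 1` (`≥ 1`, `≥ ‖S^α_x‖`): the `ō` of KT93 ii).
[cite: KomaTasaki1993, §2 ii)] -/
def sNorm (n : ℕ) : ℝ := (n : ℝ) / 2 + 1

/-- `1 ≤ s`. [cite: KomaTasaki1993, §2 ii)] -/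
theorem one_le_sNorm (n : ℕ) : 1 ≤ sNorm n := by
  unfold sNorm
  have := (Nat.cast_nonneg n : (0 : ℝ) ≤ n)
  linarith

/-- `‖S^α_x‖ ≤ s`. [cite: KomaTasaki1993, §2 ii)] -/
theorem norm_siteSpin_le_sNorm (x : Λ) (α : Fin 3) : ‖(siteSpin n x α : Op Λ (n + 1))‖ ≤ sNorm n :=
  (norm_siteSpin_le_half n x α).trans (by unfold sNorm; linarith)

/-- `‖B^α_{xy}‖ ≤ s²`. [cite: KomaTasaki1993, §2 ii)] -/
theorem norm_spinBond_le (α : Fin 3) (x y : Λ) : ‖(spinBond n α x y : Op Λ (n + 1))‖ ≤ sNorm n ^ 2 := by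
  have hx := norm_siteSpin_le_sNorm n x α
  have hy := norm_siteSpin_le_sNorm n y α
  have hs := one_le_sNorm n
  have h1 : ‖(siteSpin n x α * siteSpin n y α : Op Λ (n + 1))‖ ≤ sNorm n ^ 2 := by
    refine (norm_mul_le _ _).trans ?_
    rw [sq]; exact mul_le_mul hx hy (norm_nonneg _) (by linarith)
  have h2 : ‖(siteSpin n y α * siteSpin n x α : Op Λ (n + 1))‖ ≤ sNorm n ^ 2 := by
    refine (norm_mul_le _ _).trans ?_
    rw [sq]; exact mul_le_mul hy hx (norm_nonneg _) (by linarith)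
  rw [spinBond, norm_smul]
  have hq : ‖(1 / 2 : ℂ)‖ = 1 / 2 := by norm_num
  rw [hq]
  have := norm_add_le (siteSpin n x α * siteSpin n y α : Op Λ (n + 1)) (siteSpin n y α * siteSpin n x α)
  linarith

/-- `‖bond‖ ≤ (2 + |Δ|) s²`. [cite: KomaTasaki1993, §2 ii)] -/
theorem norm_bond_le (Δ : ℝ) (x y : Λ) : ‖bond n Δ x y‖ ≤ (2 + |Δ|) * sNorm n ^ 2 := by
  unfold bond
  have h0 := norm_spinBond_le n 0 x y
  have h1 := norm_spinBond_le n 1 x y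
  have h3 : ‖((Δ : ℂ) • spinBond n 2 x y : Op Λ (n + 1))‖ ≤ |Δ| * sNorm n ^ 2 := by
    rw [norm_smul, Complex.norm_real, Real.norm_eq_abs]
    exact mul_le_mul_of_nonneg_left (norm_spinBond_le n 2 x y) (abs_nonneg _)
  have ha := norm_add_le (spinBond n 0 x y + spinBond n 1 x y : Op Λ (n + 1)) ((Δ : ℂ) • spinBond n 2 x y)
  have hb := norm_add_le (spinBond n 0 x y : Op Λ (n + 1)) (spinBond n 1 x y)
  have he : (2 + |Δ|) * sNorm n ^ 2 = sNorm n ^ 2 + sNorm n ^ 2 + |Δ| * sNorm n ^ 2 := by ring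
  rw [he]
  linarith

/-- **The local Hamiltonian** `h_x = (J/2) Σ_{y ∼ x} bond(x,y)` (the bonds out of `x`, halved).
[cite: KomaTasaki1993, §2 (2.2)] [cite: KomaTasaki1994, §3.1] -/
def localHam (J Δ : ℝ) (x : Λ) : Op Λ (n + 1) :=
  ((J / 2 : ℝ) : ℂ) • ∑ y, if G.Adj x y then bond n Δ x y else 0

/-- **`Σ_x h_x = H_XXZ`**. [cite: KomaTasaki1993, §2 (2.2)] [cite: Tasaki2020, §2.4 eq. (2.4.1)] -/
theorem sum_localHam (J Δ : ℝ) : ∑ x, localHam n G J Δ x = xxzHamiltonian n G J Δ := by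
  unfold localHam
  rw [← Finset.smul_sum, sum_sum_adj_eq_sum_edgeFinset G, xxzHamiltonian_eq_sum_bond n G J Δ]
  have h2 : ∀ e ∈ G.edgeFinset,
      Sym2.lift ⟨fun a b => bond n Δ a b + bond n Δ b a, fun _ _ => add_comm _ _⟩ e =
        (2 : ℂ) • Sym2.lift ⟨fun x y => bond n Δ x y, fun x y => (bond_comm n Δ y x)⟩ e := by
    intro e _
    induction e with
    | h a b =>
      simp only [Sym2.lift_mk]
      rw [bond_comm n Δ a b, two_smul]
  rw [Finset.sum_congr rfl h2, ← Finset.smul_sum, smul_smul]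
  congr 1
  push_cast
  ring

/-- `h_x` is Hermitian. [cite: KomaTasaki1993, §2 (2.2)] -/
theorem isHermitian_localHam (J Δ : ℝ) (x : Λ) : (localHam n G J Δ x).IsHermitian := by
  unfold localHam
  refine IsHermitian.smul ?_ (by rw [isSelfAdjoint_iff, Complex.star_def, Complex.conj_ofReal])
  refine (isSelfAdjoint_sum Finset.univ fun y _ => ?_).isHermitian
  split_ifs
  · exact (bond_isHermitian n Δ x y).isSelfAdjoint
  · exact isHermitian_zero.isSelfAdjoint

/-- `‖h_x‖ ≤ (|J|/2) · #{y ∼ x} · (2+|Δ|) s²`. [cite: KomaTasaki1993, §2 ii)] -/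
theorem norm_localHam_le_card (J Δ : ℝ) (x : Λ) :
    ‖localHam n G J Δ x‖ ≤ |J| / 2 * (#{y | G.Adj x y} * ((2 + |Δ|) * sNorm n ^ 2)) := by
  unfold localHam
  rw [norm_smul, Complex.norm_real, Real.norm_eq_abs, abs_div, abs_two]
  refine mul_le_mul_of_nonneg_left ?_ (by positivity)
  rw [← Finset.sum_filter]
  refine (norm_sum_le _ _).trans ?_
  refine (Finset.sum_le_sum fun y _ => norm_bond_le n Δ x y).trans ?_
  rw [Finset.sum_const, nsmul_eq_mul]

/-- LOCALITY: `h_x` commutes with every spin component at a site `y ≠ x` not adjacent to `x`.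
[cite: KomaTasaki1993, §2 iii)] -/
theorem commute_localHam_siteSpin (J Δ : ℝ) {x y : Λ} (hyx : y ≠ x) (hadj : ¬ G.Adj x y) (β : Fin 3) :
    Commute (localHam n G J Δ x) (siteSpin n y β) := by
  unfold localHam
  refine Commute.smul_left (Commute.sum_left _ _ _ fun z _ => ?_) _
  split_ifs with hz
  · have hzy : z ≠ y := fun h => hadj (h ▸ hz)
    have hc : ∀ α : Fin 3, Commute (spinBond n α x z) (siteSpin n y β : Op Λ (n + 1)) := fun α => by
      unfold spinBond
      refine Commute.smul_left (Commute.add_left ?_ ?_) _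
      · exact (siteSpin_commute_of_ne_holds n hyx.symm α β).mul_left (siteSpin_commute_of_ne_holds n hzy α β)
      · exact (siteSpin_commute_of_ne_holds n hzy α β).mul_left (siteSpin_commute_of_ne_holds n hyx.symm α β)
    unfold bond
    exact ((hc 0).add_left (hc 1)).add_left ((hc 2).smul_left _)
  · exact Commute.zero_left _

/-! #### The half turn about the `3`-axis -/

/-- The tree's quarter turn `⨂_x diag((-i)^k)` about the `3`-axis. [cite: Tasaki2020, §2.2 eq. (2.2.12)] -/
def quarterTurn : Op Λ (n + 1) :=
  productOp (fun _ : Λ => diagonal fun k : Fin (n + 1) => (-Complex.I) ^ (k : ℕ))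

/-- **The half turn** `U = (quarter turn)²` (rotation by `π` about the `3`-axis).
[cite: KomaTasaki1993, §2 (2.3), (2.5)] [cite: Tasaki2020, §2.2 eq. (2.2.12)] -/
def halfTurn : Op Λ (n + 1) := quarterTurn (Λ := Λ) n * quarterTurn n

/-- `Q Qᴴ = 1` (a product of single-site unitaries is unitary). [cite: Tasaki2020, §2.2 eq. (2.2.12)] -/
theorem quarterTurn_mul_conjTranspose : quarterTurn (Λ := Λ) n * (quarterTurn n)ᴴ = 1 :=
  productOp_mul_conjTranspose fun _ => spinPhase_mul_conjTranspose n

/-- `Qᴴ Q = 1`. [cite: Tasaki2020, §2.2 eq. (2.2.12)] -/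
theorem quarterTurn_conjTranspose_mul : (quarterTurn (Λ := Λ) n)ᴴ * quarterTurn n = 1 :=
  productOp_conjTranspose_mul fun _ => spinPhase_conjTranspose_mul n

/-- `U Uᴴ = 1`. [cite: KomaTasaki1993, §2 (U_Λ unitary)] -/
theorem halfTurn_mul_conjTranspose : halfTurn (Λ := Λ) n * (halfTurn n)ᴴ = 1 := by
  rw [halfTurn, conjTranspose_mul, Matrix.mul_assoc, ← Matrix.mul_assoc (quarterTurn n) (quarterTurn n)ᴴ,
    quarterTurn_mul_conjTranspose, Matrix.one_mul, quarterTurn_mul_conjTranspose]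

/-- Conjugation by the half turn is the quarter-turn conjugation applied twice (`π = π/2 + π/2`).
[cite: Tasaki2020, §2.2 eq. (2.2.12)] -/
theorem halfTurn_conj (A : Op Λ (n + 1)) :
    halfTurn n * A * (halfTurn n)ᴴ =
      quarterTurn n * (quarterTurn n * A * (quarterTurn n)ᴴ) * (quarterTurn (Λ := Λ) n)ᴴ := by
  rw [halfTurn, conjTranspose_mul]
  simp only [Matrix.mul_assoc]

/-- `U Sʸ_x Uᴴ = -Sʸ_x`. [cite: KomaTasaki1993, §2 (2.5)] -/
theorem halfTurn_conj_siteSpin_one (x : Λ) :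
    halfTurn n * siteSpin n x 1 * (halfTurn n)ᴴ = -(siteSpin n x 1 : Op Λ (n + 1)) := by
  rw [halfTurn_conj, quarterTurn, quarterTurn_conj_siteSpin_one, quarterTurn_conj_siteSpin_zero]

/-- `U Sˣ_x Uᴴ = -Sˣ_x`. [cite: KomaTasaki1993, §2 (2.5)] -/
theorem halfTurn_conj_siteSpin_zero (x : Λ) :
    halfTurn n * siteSpin n x 0 * (halfTurn n)ᴴ = -(siteSpin n x 0 : Op Λ (n + 1)) := by
  rw [halfTurn_conj, quarterTurn, quarterTurn_conj_siteSpin_zero, Matrix.mul_neg, Matrix.neg_mul,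
    quarterTurn_conj_siteSpin_one]

/-- `U Sʸ_tot Uᴴ = -Sʸ_tot` (KT93 (2.5) for `O_Λ = Sʸ_tot`). [cite: KomaTasaki1993, §2 (2.5)] -/
theorem halfTurn_conj_totalSpin_one :
    halfTurn n * totalSpin n 1 * (halfTurn n)ᴴ = -(totalSpin n 1 : Op Λ (n + 1)) := by
  rw [totalSpin, Finset.mul_sum, Finset.sum_mul, ← Finset.sum_neg_distrib]
  exact Finset.sum_congr rfl fun x _ => halfTurn_conj_siteSpin_one n x

/-- `U H_XXZ Uᴴ = H_XXZ` (KT93 (2.3)). [cite: KomaTasaki1993, §2 (2.3)] [cite: Tasaki2020, §2.4] -/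
theorem halfTurn_conj_xxzHamiltonian (J Δ : ℝ) :
    halfTurn n * xxzHamiltonian n G J Δ * (halfTurn n)ᴴ = xxzHamiltonian n G J Δ := by
  rw [halfTurn_conj, quarterTurn, quarterTurn_conj_xxzHamiltonian, quarterTurn_conj_xxzHamiltonian]

/-! #### The `U(1)` commutators -/

/-- `[Sᶻ_tot, Sˣ_tot] = i Sʸ_tot`. [cite: Tasaki2020, §2.1 eq. (2.1.1), §2.2 (2.2.11)] [cite: KomaTasaki1994, (2.14)] -/
theorem totalSpin_two_comm_totalSpin_zero :
    (totalSpin n 2 * totalSpin n 0 - totalSpin n 0 * totalSpin n 2 : Op Λ (n + 1)) = Complex.I • totalSpin n 1 := by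
  have h : ∀ x : Λ, (siteSpin n x 2 * totalSpin n 0 - totalSpin n 0 * siteSpin n x 2 : Op Λ (n + 1)) =
      Complex.I • onSite x (spinY n) := fun x => by
    rw [siteSpin_mul_totalSpin_sub, spinVec_two, spinVec_zero, lie_spinZ_spinX, onSite_smul']
  have e2 : (totalSpin n 2 : Op Λ (n + 1)) = ∑ x, siteSpin n x 2 := rfl
  calc (totalSpin n 2 * totalSpin n 0 - totalSpin n 0 * totalSpin n 2 : Op Λ (n + 1))
      = ∑ x, (siteSpin n x 2 * totalSpin n 0 - totalSpin n 0 * siteSpin n x 2) := by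
        rw [e2, Finset.sum_mul, Finset.mul_sum, ← Finset.sum_sub_distrib]
    _ = ∑ x, Complex.I • (onSite x (spinY n) : Op Λ (n + 1)) := Finset.sum_congr rfl fun x _ => h x
    _ = Complex.I • totalSpin n 1 := by simp only [totalSpin, siteSpin, spinVec_one, Finset.smul_sum]

/-- `[Sᶻ_tot, Sʸ_tot] = -i Sˣ_tot`. [cite: Tasaki2020, §2.1 eq. (2.1.1), §2.2 (2.2.11)] [cite: KomaTasaki1994, (2.14)] -/
theorem totalSpin_two_comm_totalSpin_one :
    (totalSpin n 2 * totalSpin n 1 - totalSpin n 1 * totalSpin n 2 : Op Λ (n + 1)) = -(Complex.I • totalSpin n 0) := by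
  have h : ∀ x : Λ, (siteSpin n x 1 * totalSpin n 2 - totalSpin n 2 * siteSpin n x 1 : Op Λ (n + 1)) =
      Complex.I • onSite x (spinX n) := fun x => by
    rw [siteSpin_mul_totalSpin_sub, spinVec_one, spinVec_two, lie_spinY_spinZ, onSite_smul']
  have e1 : (totalSpin n 1 : Op Λ (n + 1)) = ∑ x, siteSpin n x 1 := rfl
  calc (totalSpin n 2 * totalSpin n 1 - totalSpin n 1 * totalSpin n 2 : Op Λ (n + 1))
      = -(totalSpin n 1 * totalSpin n 2 - totalSpin n 2 * totalSpin n 1) := (neg_sub _ _).symm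
    _ = -∑ x, (siteSpin n x 1 * totalSpin n 2 - totalSpin n 2 * siteSpin n x 1) := by
        rw [e1, Finset.sum_mul, Finset.mul_sum, ← Finset.sum_sub_distrib]
    _ = -∑ x, Complex.I • (onSite x (spinX n) : Op Λ (n + 1)) := by rw [Finset.sum_congr rfl fun x _ => h x]
    _ = -(Complex.I • totalSpin n 0) := by simp only [totalSpin, siteSpin, spinVec_zero, Finset.smul_sum]

/-- `[Sˣ_tot, Sʸ_tot] = i Sᶻ_tot`. [cite: Tasaki2020, §2.1 eq. (2.1.1), §2.2 (2.2.11)] [cite: KomaTasaki1993, (7.22)] -/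
theorem totalSpin_zero_comm_totalSpin_one :
    (totalSpin n 0 * totalSpin n 1 - totalSpin n 1 * totalSpin n 0 : Op Λ (n + 1)) = Complex.I • totalSpin n 2 := by
  have h : ∀ x : Λ, (siteSpin n x 0 * totalSpin n 1 - totalSpin n 1 * siteSpin n x 0 : Op Λ (n + 1)) =
      Complex.I • onSite x (SpinOperators.spinZ n) := fun x => by
    rw [siteSpin_mul_totalSpin_sub, spinVec_zero, spinVec_one, lie_spinX_spinY, onSite_smul']
  have e0 : (totalSpin n 0 : Op Λ (n + 1)) = ∑ x, siteSpin n x 0 := rfl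
  calc (totalSpin n 0 * totalSpin n 1 - totalSpin n 1 * totalSpin n 0 : Op Λ (n + 1))
      = ∑ x, (siteSpin n x 0 * totalSpin n 1 - totalSpin n 1 * siteSpin n x 0) := by
        rw [e0, Finset.sum_mul, Finset.mul_sum, ← Finset.sum_sub_distrib]
    _ = ∑ x, Complex.I • (onSite x (SpinOperators.spinZ n) : Op Λ (n + 1)) := Finset.sum_congr rfl fun x _ => h x
    _ = Complex.I • totalSpin n 2 := by simp only [totalSpin, siteSpin, spinVec_two, Finset.smul_sum]

/-- `‖S^α_tot‖ ≤ s·|Λ|`. [cite: KomaTasaki1993, §2 ii)] -/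
theorem norm_totalSpin_le (α : Fin 3) : ‖(totalSpin n α : Op Λ (n + 1))‖ ≤ sNorm n * Fintype.card Λ :=
  calc ‖(totalSpin n α : Op Λ (n + 1))‖ ≤ ∑ x : Λ, ‖(siteSpin n x α : Op Λ (n + 1))‖ := norm_sum_le _ _
    _ ≤ ∑ _x : Λ, sNorm n := Finset.sum_le_sum fun x _ => norm_siteSpin_le_sNorm n x α
    _ = sNorm n * Fintype.card Λ := by rw [Finset.sum_const, Finset.card_univ, nsmul_eq_mul, mul_comm]

/-- **The commutator bound** `‖[Sˣ_tot, Sʸ_tot]‖ ≤ 1·s²·|Λ|` (KT93 (7.22): only diagonal terms survive).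
[cite: KomaTasaki1993, (7.22)] -/
theorem norm_comm_totalSpin_zero_one_le :
    ‖(totalSpin n 0 * totalSpin n 1 - totalSpin n 1 * totalSpin n 0 : Op Λ (n + 1))‖ ≤
      1 * sNorm n ^ 2 * Fintype.card Λ := by
  rw [totalSpin_zero_comm_totalSpin_one, norm_smul, Complex.norm_I, one_mul, one_mul]
  refine (norm_totalSpin_le n 2).trans ?_
  have hs := one_le_sNorm n
  have hN : (0 : ℝ) ≤ Fintype.card Λ := Nat.cast_nonneg _
  nlinarith [mul_nonneg (sub_nonneg.2 hs) (mul_nonneg (zero_le_one.trans hs) hN)]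

end Graph

/-! ### §2. The torus `(ℤ/Lℤ)^d`: the `ℤ₂` system -/

section Torus

variable (d L n : ℕ) [NeZero L]

/-- The closed neighbourhood `{x} ∪ {y : x ∼ y}` in the torus graph (the support set `S(x)` of iii)).
[cite: KomaTasaki1993, §2 iii)] -/
def nbhd (x : TorusSite d L) : Finset (TorusSite d L) :=
  insert x (Finset.univ.filter fun y => (torusGraph d L).Adj x y)

/-- `|nbhd x| ≤ 2d + 1`. [cite: KomaTasaki1993, §2 iii)] -/
theorem card_nbhd_le (x : TorusSite d L) : (nbhd d L x).card ≤ 2 * d + 1 := by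
  have h := card_filter_torusGraph_adj_le (d := d) L x
  exact (Finset.card_insert_le _ _).trans (by omega)

/-- The uniform local-Hamiltonian bound `h̄ = (|J|/2)·2d·(2+|Δ|)s²`. [cite: KomaTasaki1993, §2 ii)] -/
def hbar (J Δ : ℝ) : ℝ := |J| / 2 * ((2 * d : ℕ) * ((2 + |Δ|) * sNorm n ^ 2))

/-- `‖h_x‖ ≤ h̄` on the torus (at most `2d` neighbours). [cite: KomaTasaki1993, §2 ii)] -/
theorem norm_localHam_le (J Δ : ℝ) (x : TorusSite d L) :
    ‖localHam n (torusGraph d L) J Δ x‖ ≤ hbar d n J Δ := by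
  refine (norm_localHam_le_card n (torusGraph d L) J Δ x).trans ?_
  unfold hbar
  refine mul_le_mul_of_nonneg_left (mul_le_mul_of_nonneg_right ?_ (by positivity)) (by positivity)
  exact_mod_cast card_filter_torusGraph_adj_le (d := d) L x

/-- **THE XXZ MODEL ON THE TORUS AS A KOMA–TASAKI `ℤ₂` SYSTEM** (KT93 §2 (2.1)–(2.5), ii), iii)):
`N = |Λ| = L^d` sites (enumerated by `Fintype.equivFin`), `h_x` the halved XXZ bonds out of `x`
(`Σ_x h_x = xxzHamiltonian n (torusGraph d L) J Δ`), `o_x = Sʸ_x` (`O_Λ = Sʸ_tot`), `U_Λ` the half turn about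
the `3`-axis ((2.3) `U H Uᴴ = H`, (2.5) `U Sʸ_tot Uᴴ = -Sʸ_tot`), `S(x) = nbhd x` (`|S(x)| ≤ 2d+1 ≤ r := 2d+2`,
so that `r ≥ 2` also for `d = 0`), `h̄ = hbar`,
`ō = s`. [cite: KomaTasaki1993, §2 (2.1)–(2.9), ii), iii)] [cite: Tasaki2019Tower, §3.2 eq. (3.7)] -/
def z2System (J Δ : ℝ) :
    KomaTasaki.Z2System (Fintype.card (TorusSite d L)) (hbar d n J Δ) (sNorm n) (2 * d + 2)
      (TorusSite d L → Fin (n + 1)) where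
  h i := localHam n (torusGraph d L) J Δ ((Fintype.equivFin (TorusSite d L)).symm i)
  o i := siteSpin n ((Fintype.equivFin (TorusSite d L)).symm i) 1
  U := halfTurn n
  supp i := (nbhd d L ((Fintype.equivFin (TorusSite d L)).symm i)).map (Fintype.equivFin (TorusSite d L)).toEmbedding
  isHermitian_h i := isHermitian_localHam n _ J Δ _
  isHermitian_o i := siteSpin_isHermitian n _ 1
  U_mul_conjTranspose := halfTurn_mul_conjTranspose n
  conj_hamiltonian := by
    rw [(Fintype.equivFin (TorusSite d L)).symm.sum_comp (fun y => localHam n (torusGraph d L) J Δ y), sum_localHam,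
      halfTurn_conj_xxzHamiltonian]
  conj_order := by
    rw [(Fintype.equivFin (TorusSite d L)).symm.sum_comp (fun y => (siteSpin n y 1 : Op (TorusSite d L) (n + 1)))]
    exact halfTurn_conj_totalSpin_one n
  norm_h_le i := norm_localHam_le d L n J Δ _
  norm_o_le i := norm_siteSpin_le_sNorm n _ 1
  commute_h_o i j hj := by
    have hj' : (Fintype.equivFin (TorusSite d L)).symm j ∉ nbhd d L ((Fintype.equivFin (TorusSite d L)).symm i) := by
      rwa [Finset.mem_map_equiv] at hj
    have hne : (Fintype.equivFin (TorusSite d L)).symm j ≠ (Fintype.equivFin (TorusSite d L)).symm i := fun h =>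
      hj' (h ▸ Finset.mem_insert_self _ _)
    have hadj : ¬ (torusGraph d L).Adj ((Fintype.equivFin (TorusSite d L)).symm i)
        ((Fintype.equivFin (TorusSite d L)).symm j) := fun h =>
      hj' (Finset.mem_insert_of_mem (Finset.mem_filter.2 ⟨Finset.mem_univ _, h⟩))
    exact commute_localHam_siteSpin n (torusGraph d L) J Δ hne hadj 1
  card_supp_le i := by
    rw [Finset.card_map]
    exact (card_nbhd_le d L _).trans (by omega)
  two_le_r := by omega

/-! #### Dictionary -/

/-- `H_Λ = xxzHamiltonian n (torusGraph d L) J Δ`. [cite: KomaTasaki1993, §2 (2.2)] -/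
theorem z2System_hamiltonian (J Δ : ℝ) :
    (z2System d L n J Δ).hamiltonian = xxzHamiltonian n (torusGraph d L) J Δ := by
  rw [KomaTasaki.Z2System.hamiltonian]
  change ∑ i, localHam n (torusGraph d L) J Δ ((Fintype.equivFin (TorusSite d L)).symm i) = _
  rw [(Fintype.equivFin (TorusSite d L)).symm.sum_comp (fun y => localHam n (torusGraph d L) J Δ y), sum_localHam]

/-- `O_Λ = Sʸ_tot`. [cite: KomaTasaki1993, §2 (2.4)] -/
theorem z2System_order (J Δ : ℝ) :
    (z2System d L n J Δ).order = (totalSpin n 1 : Op (TorusSite d L) (n + 1)) := by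
  rw [KomaTasaki.Z2System.order]
  change ∑ i, (siteSpin n ((Fintype.equivFin (TorusSite d L)).symm i) 1 : Op (TorusSite d L) (n + 1)) = _
  rw [(Fintype.equivFin (TorusSite d L)).symm.sum_comp (fun y => (siteSpin n y 1 : Op (TorusSite d L) (n + 1))),
    totalSpin]

/-- `H_Λ(B) = H_XXZ - B·Sʸ_tot`. [cite: KomaTasaki1993, §2 (2.6)] -/
theorem z2System_fieldHamiltonian (J Δ B : ℝ) :
    (z2System d L n J Δ).fieldHamiltonian B =
      xxzHamiltonian n (torusGraph d L) J Δ - (B : ℂ) • totalSpin n 1 := by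
  rw [KomaTasaki.Z2System.fieldHamiltonian, z2System_hamiltonian, z2System_order]

/-- `m_Λ(B) = |Λ|⁻¹ Re⟨Sʸ_tot⟩_{β, H_XXZ - B·Sʸ_tot}`. [cite: KomaTasaki1993, §2 (2.9), (2.11)] -/
theorem z2System_magnetisation (J Δ β B : ℝ) :
    (z2System d L n J Δ).magnetisation β B =
      (Fintype.card (TorusSite d L) : ℝ)⁻¹ *
        (gibbsState β (xxzHamiltonian n (torusGraph d L) J Δ - (B : ℂ) • totalSpin n 1) (totalSpin n 1)).re := by
  rw [KomaTasaki.Z2System.magnetisation, z2System_fieldHamiltonian, z2System_order]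

/-- **`N⁻²⟨O_Λ²⟩_Λ(0) = |Λ|⁻² Σ_{x,y} Re⟨Sʸ_xSʸ_y⟩_β`** — the symmetric second moment is the long-range order
quantity of `gibbsXXZCorrTorus 1`. [cite: KomaTasaki1993, §2 (2.12)] [cite: Tasaki2019Tower, §3.2 eq. (3.7)] -/
theorem z2System_moment_one (J Δ β : ℝ) :
    (z2System d L n J Δ).moment β 1 =
      (∑ x : TorusSite d L, ∑ y : TorusSite d L, gibbsXXZCorrTorus 1 (d := d) β L n J Δ x y) /
        (Fintype.card (TorusSite d L) : ℝ) ^ 2 := by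
  rw [KomaTasaki.Z2System.moment, z2System_hamiltonian, z2System_order, mul_one, div_eq_inv_mul]
  congr 1
  rw [pow_two, totalSpin, Finset.sum_mul_sum, map_sum, Complex.re_sum]
  refine Finset.sum_congr rfl fun x _ => ?_
  rw [map_sum, Complex.re_sum]
  refine Finset.sum_congr rfl fun y _ => ?_
  rw [gibbsXXZCorrTorus_of_neZero]

/-- `|Λ| = L^d`. [folklore] -/
private theorem card_torusSite : Fintype.card (TorusSite d L) = L ^ d := by
  rw [Fintype.card_pi, prod_const, ZMod.card, card_univ, Fintype.card_fin]

/-- **`log dim ≤ |Λ| log(n+1)`** (`dim = (n+1)^{|Λ|}`): the dimension hypothesis of the subsequence theorems for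
quantum spins `S = n/2`. [cite: KomaTasaki1993, §2 (2.1)] -/
theorem log_card_config_le :
    Real.log (Fintype.card (TorusSite d L → Fin (n + 1))) ≤ Real.log (n + 1) * Fintype.card (TorusSite d L) := by
  rw [Fintype.card_fun, Fintype.card_fin, Nat.cast_pow, Real.log_pow, Nat.cast_succ, mul_comm]

end Torus

/-! ### §3. Hard-core bosons / planar XXZ: spontaneous `U(1)`-breaking order parameter at `T > 0`, `d ≥ 3` -/

section Thermal

variable {d : ℕ}

/-- `|Λ_{2(j+1)}| = (2(j+1))^d → ∞`. [cite: KomaTasaki1993, §2 (|Λ| → ∞)] -/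
theorem tendsto_card_torusSite_two_mul_succ (hd : 1 ≤ d) :
    Tendsto (fun j : ℕ => Fintype.card (TorusSite d (2 * (j + 1)))) atTop atTop := by
  have h : (fun j : ℕ => Fintype.card (TorusSite d (2 * (j + 1)))) = fun j => (2 * (j + 1)) ^ d :=
    funext fun j => card_torusSite d (2 * (j + 1))
  have h2 : Tendsto (fun j : ℕ => 2 * (j + 1)) atTop atTop :=
    Filter.tendsto_atTop_atTop.2 fun b => ⟨b, fun j hj => by omega⟩
  rw [h]
  exact (tendsto_pow_atTop (by omega)).comp h2

/-- From `HasEvenTorusLRO` to an eventual floor on the symmetric second moments: there is `σ > 0` with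
`σ² ≤ |Λ|⁻²Σ_{x,y}Re⟨Sʸ_xSʸ_y⟩_β` on all large even tori. [cite: KomaTasaki1993, §2 (2.12)] -/
theorem exists_sq_le_moment_of_hasEvenTorusLRO {n : ℕ} {J Δ β : ℝ}
    (h : HasEvenTorusLRO (fun L x y => gibbsXXZCorrTorus 1 (d := d) β L n J Δ x y)) :
    ∃ σ : ℝ, 0 < σ ∧ ∀ᶠ j : ℕ in atTop, σ ^ 2 ≤ (z2System d (2 * (j + 1)) n J Δ).moment β 1 := by
  rw [hasEvenTorusLRO_iff] at h
  obtain ⟨f, hf, hpos⟩ : ∃ f : ℕ → ℝ, (∀ k, f k = (∑ x ∈ halfOpenBox d (2 * k), ∑ y ∈ halfOpenBox d (2 * k),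
      torusPullback (fun L x y => gibbsXXZCorrTorus 1 (d := d) β L n J Δ x y) (2 * k) x y) /
        ((halfOpenBox d (2 * k)).card : ℝ) ^ 2) ∧ 0 < liminf f atTop := ⟨_, fun _ => rfl, h⟩
  have hmom : ∀ j : ℕ, f (j + 1) = (z2System d (2 * (j + 1)) n J Δ).moment β 1 := fun j => by
    rw [hf, z2System_moment_one, card_torusSite, card_halfOpenBox]
    simp only [torusPullback_apply]
    rw [sum_sq_halfOpenBox_comp_torusProj]
  have hnonneg : ∀ j : ℕ, 0 ≤ f (j + 1) := fun j => by
    rw [hmom]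
    exact KomaTasaki.Z2System.moment_nonneg _ β 1
  have hlim : 0 < liminf (fun j : ℕ => f (j + 1)) atTop := by
    rw [Filter.liminf_nat_add f 1]
    exact hpos
  have hcl : liminf (fun j : ℕ => f (j + 1)) atTop / 2 < liminf (fun j : ℕ => f (j + 1)) atTop :=
    half_lt_self hlim
  have hev := eventually_lt_of_lt_liminf hcl (isBoundedUnder_of ⟨0, fun j => hnonneg j⟩)
  refine ⟨Real.sqrt (liminf (fun j : ℕ => f (j + 1)) atTop / 2), Real.sqrt_pos.2 (half_pos hlim),
    hev.mono fun j hj => ?_⟩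
  rw [Real.sq_sqrt (half_pos hlim).le, ← hmom]
  exact hj.le

/-- **ENGINE (XXZ on the even tori, any `J, Δ`, every `β > 0`).**  Plain long-range order of `Sʸ` in the
symmetric Gibbs states (`HasEvenTorusLRO` of `gibbsXXZCorrTorus 1`) forces, for some `σ > 0` and every `B > 0`,
`ε > 0`, eventually on the even tori `(ℤ/2(j+1)ℤ)^d`: `√2 σ - ε ≤ |Λ|⁻¹ Re⟨Sʸ_tot⟩_{β, H_XXZ - B·Sʸ_tot}` — KT93
Theorem 2.1 with the `U(1)` factor `√2` (generator `Sᶻ_tot`, second component `Sˣ_tot`, Corollary 2.2 / Remark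
after Theorem 6.1), hypothesis i) removed (`le_sqrt_two_mul_magnetisation_add_of_eventually_moment_one_u1`).
[cite: KomaTasaki1993, Theorem 2.1 (2.13), Corollary 2.2 with Remark after Theorem 6.1] -/
theorem thermal_orderParameter_ge_of_hasEvenTorusLRO (hd : 1 ≤ d) {n : ℕ} {J Δ β : ℝ} (hβ : 0 < β)
    (h : HasEvenTorusLRO (fun L x y => gibbsXXZCorrTorus 1 (d := d) β L n J Δ x y)) :
    ∃ σ : ℝ, 0 < σ ∧ ∀ B : ℝ, 0 < B → ∀ ε : ℝ, 0 < ε → ∀ᶠ j : ℕ in atTop,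
      Real.sqrt 2 * σ - ε ≤ (Fintype.card (TorusSite d (2 * (j + 1))) : ℝ)⁻¹ *
        (gibbsState β (xxzHamiltonian n (torusGraph d (2 * (j + 1))) J Δ - (B : ℂ) • totalSpin n 1)
          (totalSpin n 1)).re := by
  obtain ⟨σ, hσ, hLRO⟩ := exists_sq_le_moment_of_hasEvenTorusLRO h
  refine ⟨σ, hσ, fun B hB ε hε => ?_⟩
  have hev := KomaTasaki.Z2System.le_sqrt_two_mul_magnetisation_add_of_eventually_moment_one_u1
    (fun j => z2System d (2 * (j + 1)) n J Δ) (fun _ => totalSpin n 0) (fun _ => totalSpin n 2)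
    Complex.I_ne_zero zero_le_one (fun _ => totalSpin_isHermitian n 0)
    (fun j => by
      rw [z2System_hamiltonian]
      exact HardCoreBoson.commute_xxzHamiltonian_totalSpin_two n _ J Δ)
    (fun j => by
      rw [z2System_order]
      exact totalSpin_two_comm_totalSpin_zero n)
    (fun j => by
      rw [z2System_order]
      exact totalSpin_two_comm_totalSpin_one n)
    (fun _ => norm_totalSpin_le n 0)
    (fun j => by
      rw [z2System_order]
      exact norm_comm_totalSpin_zero_one_le n)
    (zero_le_one.trans (one_le_sNorm n)) hβ (tendsto_card_torusSite_two_mul_succ hd)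
    (fun j => log_card_config_le d (2 * (j + 1)) n) hσ.le hLRO hB hε
  filter_upwards [hev] with j hj
  rw [z2System_magnetisation] at hj
  linarith

/-- **OFF-DIAGONAL LONG-RANGE ORDER OF HARD-CORE LATTICE BOSONS AT `T > 0` FORCES A SPONTANEOUS `U(1)`-BREAKING
ORDER PARAMETER** (KT93 Theorem 2.1 / Corollary 2.2-`U(1)` BY NAME, hypothesis i) removed).  For `d ≥ 3`,
`S = n/2 ≥ ½` and `-1 ≤ Δ ≤ 0` there is `β₀ > 0` such that for every `β ≥ β₀` there is `σ > 0` with: for every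
symmetry-breaking field `B > 0` and every `ε > 0`, eventually on the even tori `(ℤ/2(j+1)ℤ)^d`,
**`√2 σ - ε ≤ |Λ|⁻¹ Re⟨Sʸ_tot⟩_{β, H - B·Sʸ_tot}`**, `H = xxzHamiltonian n (torusGraph d (2(j+1))) (-1) Δ
= -Σ_{⟨x,y⟩}(SˣSˣ + SʸSʸ + ΔSᶻSᶻ)` (planar ferromagnet with Ising coupling `|Δ| ≤ 1`; for `S = ½`, hard-core bosons
with nearest-neighbour interaction, the order parameter being the condensate amplitude
`|Λ|⁻¹Σ_x⟨(a_x - a†_x)/2i⟩`).  Hence `liminf_Λ m_Λ(B) ≥ √2σ` for every `B > 0` and `m_s ≥ √2 σ > 0` along every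
convergent choice of the limits (2.11).  The long-range order is the tree's `hardCoreBoson_thermal_planar`.
[cite: KomaTasaki1993, Theorem 2.1 (2.13), Corollary 2.2 (2.18) with Remark after Theorem 6.1, (2.11)]
[cite: Tasaki2019Tower, §3.2] [cite: BjornbergUeltschi2022, Theorem 3.2] -/
theorem hardCoreBoson_thermal_spontaneousOrder (hd : 3 ≤ d) {n : ℕ} (hn : 1 ≤ n) {Δ : ℝ} (hΔ : -1 ≤ Δ)
    (hΔ' : Δ ≤ 0) :
    ∃ β₀ : ℝ, 0 < β₀ ∧ ∀ β : ℝ, β₀ ≤ β → ∃ σ : ℝ, 0 < σ ∧ ∀ B : ℝ, 0 < B → ∀ ε : ℝ, 0 < ε →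
      ∀ᶠ j : ℕ in atTop,
        Real.sqrt 2 * σ - ε ≤ (Fintype.card (TorusSite d (2 * (j + 1))) : ℝ)⁻¹ *
          (gibbsState β (xxzHamiltonian n (torusGraph d (2 * (j + 1))) (-1) Δ - (B : ℂ) • totalSpin n 1)
            (totalSpin n 1)).re := by
  obtain ⟨β₀, hβ₀, hlro⟩ := hardCoreBoson_thermal_planar hd hn hΔ hΔ'
  exact ⟨β₀, hβ₀, fun β hβ =>
    thermal_orderParameter_ge_of_hasEvenTorusLRO (by omega) (lt_of_lt_of_le hβ₀ hβ) (hlro β hβ)⟩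

/-- The plain KT93 Theorem 2.1 form (factor `1`): with `σ > 0` as above, for every `B > 0`, `ε > 0`, eventually
`σ - ε ≤ |Λ|⁻¹ Re⟨Sʸ_tot⟩_{β, H - B·Sʸ_tot}`. [cite: KomaTasaki1993, Theorem 2.1 (2.13)] -/
theorem hardCoreBoson_thermal_spontaneousOrder_thm21 (hd : 3 ≤ d) {n : ℕ} (hn : 1 ≤ n) {Δ : ℝ} (hΔ : -1 ≤ Δ)
    (hΔ' : Δ ≤ 0) :
    ∃ β₀ : ℝ, 0 < β₀ ∧ ∀ β : ℝ, β₀ ≤ β → ∃ σ : ℝ, 0 < σ ∧ ∀ B : ℝ, 0 < B → ∀ ε : ℝ, 0 < ε →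
      ∀ᶠ j : ℕ in atTop,
        σ - ε ≤ (Fintype.card (TorusSite d (2 * (j + 1))) : ℝ)⁻¹ *
          (gibbsState β (xxzHamiltonian n (torusGraph d (2 * (j + 1))) (-1) Δ - (B : ℂ) • totalSpin n 1)
            (totalSpin n 1)).re := by
  obtain ⟨β₀, hβ₀, h⟩ := hardCoreBoson_thermal_spontaneousOrder hd hn hΔ hΔ'
  refine ⟨β₀, hβ₀, fun β hβ => ?_⟩
  obtain ⟨σ, hσ, hB⟩ := h β hβ
  refine ⟨σ, hσ, fun B hB' ε hε => (hB B hB' ε hε).mono fun j hj => ?_⟩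
  have h2 : σ ≤ Real.sqrt 2 * σ := by
    have := Real.one_lt_sqrt_two
    nlinarith
  linarith

end Thermal

end XXZKT

end Literature.MathematicalPhysics.QuantumLattice
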